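/-
Copyright (c) 2026 the pub-hodgecm-mathlib formalisation cell (harness21).  Prover seat hodgecm-mathlib-K2E3-p12 (g4), Track B «K2-LIT» ∕ h413
(`stmt-HodgeConjecture-24833`), line `K2_E3_EllipticInputs`, unit U12-d, §L (S2b): THE REGULAR NILPOTENT ORBIT `𝒪_reg = 𝒩 ∖ {0} ⊂ 𝔤𝔩₂(F)` AS A
`ConjAct GL₂(F)`-SPACE — one orbit, locally closed, carrying the invariant Radon measure `μ = val^* ν` (`ν = chart_*(κ ⊗ dx)`, ★ p856878).  2026-09-04.
-/
import Summits.HodgeConjecture.HodgeConjecture.Theorems.K2E3GL2RegularNilpotentOrbitPushforward   -- ★ p856878 (K2E3-p12 g3): `ν`, `map_conj_map_conjNilp`, null sets, `integral_map_conjNilp`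
import Summits.HodgeConjecture.HodgeConjecture.Theorems.K2E3GL2RegularNilpotentOrbitStructure      -- ★ p856767 (K2E3-p12 g3): `exists_units_conj_nilp_one_eq`
import Mathlib.GroupTheory.GroupAction.ConjAct
import Mathlib.Topology.LocallyClosed
import HarnessLib

/-!
# K2_E3 road (h413), §L — S2b: the regular nilpotent orbit of `𝔤𝔩₂(F)` as a homogeneous `ConjAct GL₂(F)`-space with invariant measure

Cell `pub/hodgecm-mathlib` (D-0151), Track B, seat K2E3-p12 (g4), §L line lead (dealer K2E3-plan (g2), D41 re-booked to this seat 2026-09-04T02:58Z).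
`--supports stmt-HodgeConjecture-24833 --as helper`; THEOREMS ONLY (no definition ∕ instance ∕ notation ∕ named fact ∕ `sorry`); never imports `Cruxes/…/Lines`.
COUNT-NEUTRAL.

Purpose.  The structure leaf (LBGL-2a′) «`T = c·μ_reg` on the test functions vanishing near `0`» of (L-B_GL) at `N = 2` (★ p856851
`gl2_nilpotentStructure_of_puncturedCone`, ★ p856788) is the uniqueness of invariant functionals on ONE orbit (★ COINV-1
`Literature.MeasureTheory.Group.exists_forall_apply_eq_const_mul_integral_of_smul_invariant_of_additive`).  COINV-1 wants a group `G` acting transitively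
on a space `X` and a `G`-invariant measure on `X`, finite on compacta and positive on opens.  This file builds that input in Mathlib's `ConjAct` currency:
`G := ConjAct (GL (Fin 2) F)` acting on `𝔤𝔩₂(F)` by `g • X = g X g⁻¹` (Mathlib `ConjAct.unitsMulDistribMulAction`), `X := ↥(orbit G E₁₂)`, and
`μ := Measure.comap Subtype.val ν` with `ν = chart_*(κ ⊗ dx)` the push-forward of ★ p856878.
* §1 (any field) **`mem_orbit_nilpOne_iff`**: `orbit G E₁₂ = {N | IsNilpotent N ∧ N ≠ 0}` (⊇ ★ `exists_units_conj_nilp_one_eq`, ⊆ ★ `isNilpotent_conj_nilp` +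
  ★ `conjNilp_eq_zero_iff`); `image_val_preimage_smul` (the orbit is stable, so `val '' ((g • ·)⁻¹' s) = (Ad g)⁻¹' (val '' s)`); over a Hausdorff topological
  field the orbit is LOCALLY CLOSED (`isLocallyClosed_orbit_nilpOne`: closed cone ★ `isClosed_setOf_isNilpotent` minus the point `0`), its closure lies in
  `𝒩 = orbit ∪ {0}`, and it is a Borel set.
* §2 (non-archimedean local `F`, Haar pair `(κ, dx)`) the measure `μ = val^* ν` on `X`: `comap_val_apply` (`μ s = ν (val '' s)`), **`isFiniteMeasureOnCompacts_comap_val`**,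
  **`smulInvariantMeasure_comap_val`** (from ★ `map_conj_map_conjNilp`), `map_conjNilp_apply_compl_orbit` (`ν(orbitᶜ) = 0`), `comap_val_univ`, **`comap_val_ne_zero`**,
  and **`integral_comp_val_comap_val`** (`∫_X f∘val dμ = μ_reg(f)`, ★ `integral_map_conjNilp`).
The topological-group structure on the synonym `ConjAct (GL (Fin 2) F)` (open orbit maps, positivity on opens, COINV-1 itself) is set up by the consumer S2c
`K2E3GL2NilpotentOneOrbitUniqueness` inside its proof, exactly as ★ `Literature.MeasureTheory.Group.OrbitalIntegralKernelDecompositionStratum` does.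
[HarishChandra1999AdmissibleDistributions, §3 pp. 8–10 (the regular nilpotent orbit and its invariant measure, after Deligne–Ranga Rao)];
[BernsteinZelevinsky1976, §1.18].

References: [HarishChandra1999AdmissibleDistributions] Harish-Chandra (DeBacker–Sally), AMS ULECT 16 (1999), §3 pp. 8–10, Thm. 3.9, Cor. 3.10 ·
[BernsteinZelevinsky1976] Russian Math. Surveys 31:3 (1976), §1.5, §1.18 · [RangaRao1972] R. Ranga Rao, Ann. of Math. 96 (1972) 505–510.
-/

set_option autoImplicit false
set_option linter.dupNamespace false   -- `Summit.HodgeConjecture.HodgeConjecture.…` (D-0017 nested layout; lakefile exemption for Summits)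

noncomputable section

open MeasureTheory Measure Filter Topology TopologicalSpace
open scoped MatrixGroups NNReal ENNReal
open Literature.NumberTheory.Rogawski1990 Literature.NumberTheory.Automorphic Literature.NumberTheory.Automorphic.LocalFieldHaar
open Literature.NumberTheory.GaloisRepresentations Literature.NumberTheory.GaloisRepresentations.IsNonarchimedeanLocalField
open Summit.HodgeConjecture.HodgeConjecture.Cruxes.H413.K2E3GL2RegularNilpotentOrbitalMeasure
open Summit.HodgeConjecture.HodgeConjecture.Cruxes.H413.K2E3GL2RegularNilpotentOrbitStructure
open Summit.HodgeConjecture.HodgeConjecture.Cruxes.H413.K2E3GL2RegularNilpotentOrbitPushforward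

namespace Summit.HodgeConjecture.HodgeConjecture.Cruxes.H413.K2E3GL2RegularNilpotentOrbitSpace

/-! ## §1  The orbit of `E₁₂` under `ConjAct GL₂(F)` is the punctured nilpotent cone -/

section Orbit

variable {F : Type*} [Field F]

/-- **`orbit (ConjAct GL₂(F)) E₁₂ = 𝒩 ∖ {0}`**: a `2 × 2` matrix is `GL₂(F)`-conjugate to `E₁₂` iff it is nilpotent and non-zero (rank-one normal form ★
`exists_units_conj_nilp_one_eq`; conversely `g E₁₂ g⁻¹` is nilpotent, ★ `isNilpotent_conj_nilp`, and non-zero, ★ `conjNilp_eq_zero_iff`).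
[cite: HarishChandra1999AdmissibleDistributions, §3 p. 8] -/
theorem mem_orbit_nilpOne_iff (X : Matrix (Fin 2) (Fin 2) F) :
    X ∈ MulAction.orbit (ConjAct (GL (Fin 2) F)) (!![0, 1; 0, 0] : Matrix (Fin 2) (Fin 2) F) ↔ IsNilpotent X ∧ X ≠ 0 := by
  rw [MulAction.mem_orbit_iff]
  constructor
  · rintro ⟨g, rfl⟩
    rw [ConjAct.units_smul_def]
    exact ⟨isNilpotent_conj_nilp (ConjAct.ofConjAct g) 1,
      fun h => one_ne_zero ((conjNilp_eq_zero_iff (ConjAct.ofConjAct g) (1 : F)).1 h)⟩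
  · rintro ⟨hX, h0⟩
    obtain ⟨g, hg⟩ := exists_units_conj_nilp_one_eq hX h0
    exact ⟨ConjAct.toConjAct g, by rw [ConjAct.units_smul_def, ConjAct.ofConjAct_toConjAct, hg]⟩

/-- Set form: `orbit (ConjAct GL₂(F)) E₁₂ = {N | IsNilpotent N} ∩ {0}ᶜ`. [cite: HarishChandra1999AdmissibleDistributions, §3 p. 8] -/
theorem orbit_nilpOne_eq :
    MulAction.orbit (ConjAct (GL (Fin 2) F)) (!![0, 1; 0, 0] : Matrix (Fin 2) (Fin 2) F) =
      {N : Matrix (Fin 2) (Fin 2) F | IsNilpotent N} ∩ {0}ᶜ := by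
  ext X
  rw [mem_orbit_nilpOne_iff]
  rfl

/-- `0` is not on the regular nilpotent orbit. [cite: HarishChandra1999AdmissibleDistributions, §3 p. 8] -/
theorem zero_notMem_orbit_nilpOne :
    (0 : Matrix (Fin 2) (Fin 2) F) ∉ MulAction.orbit (ConjAct (GL (Fin 2) F)) (!![0, 1; 0, 0] : Matrix (Fin 2) (Fin 2) F) :=
  fun h => ((mem_orbit_nilpOne_iff _).1 h).2 rfl

/-- Every chart point `k (tE₁₂) k⁻¹` with `t ≠ 0` lies on the orbit of `E₁₂`. [cite: HarishChandra1999AdmissibleDistributions, §3 p. 9] -/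
theorem conj_nilp_mem_orbit_nilpOne (k : GL (Fin 2) F) {t : F} (ht : t ≠ 0) :
    (k : Matrix (Fin 2) (Fin 2) F) * !![0, t; 0, 0] * ((k⁻¹ : GL (Fin 2) F) : Matrix (Fin 2) (Fin 2) F) ∈
      MulAction.orbit (ConjAct (GL (Fin 2) F)) (!![0, 1; 0, 0] : Matrix (Fin 2) (Fin 2) F) :=
  (mem_orbit_nilpOne_iff _).2 ⟨isNilpotent_conj_nilp k t, fun h => ht ((conjNilp_eq_zero_iff k t).1 h)⟩

/-- A nilpotent matrix is `0` or on the orbit of `E₁₂`: `𝒩 = {0} ∪ 𝒪_reg`. [cite: HarishChandra1999AdmissibleDistributions, §3 p. 8] -/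
theorem eq_zero_or_mem_orbit_nilpOne_of_isNilpotent {X : Matrix (Fin 2) (Fin 2) F} (hX : IsNilpotent X) :
    X = 0 ∨ X ∈ MulAction.orbit (ConjAct (GL (Fin 2) F)) (!![0, 1; 0, 0] : Matrix (Fin 2) (Fin 2) F) := by
  by_cases h0 : X = 0
  · exact Or.inl h0
  · exact Or.inr ((mem_orbit_nilpOne_iff X).2 ⟨hX, h0⟩)

/-- **The orbit is stable**, so pre-images of subsets of the orbit under the orbit action are read in `𝔤𝔩₂(F)`:
`val '' ((g • ·)⁻¹' s) = (Ad g)⁻¹' (val '' s)` for `s ⊆ ↥(orbit)` (the set identity behind the invariance of `μ = val^* ν`). [cite: BernsteinZelevinsky1976, §1.5] -/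
theorem image_val_preimage_smul (c : ConjAct (GL (Fin 2) F))
    (s : Set ↥(MulAction.orbit (ConjAct (GL (Fin 2) F)) (!![0, 1; 0, 0] : Matrix (Fin 2) (Fin 2) F))) :
    Subtype.val '' ((fun x : ↥(MulAction.orbit (ConjAct (GL (Fin 2) F)) (!![0, 1; 0, 0] : Matrix (Fin 2) (Fin 2) F)) => c • x) ⁻¹' s) =
      (fun Y : Matrix (Fin 2) (Fin 2) F => ((ConjAct.ofConjAct c : GL (Fin 2) F) : Matrix (Fin 2) (Fin 2) F) * Y *
        (((ConjAct.ofConjAct c)⁻¹ : GL (Fin 2) F) : Matrix (Fin 2) (Fin 2) F)) ⁻¹' (Subtype.val '' s) := by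
  ext Y
  simp only [Set.mem_image, Set.mem_preimage]
  constructor
  · rintro ⟨x, hx, rfl⟩
    refine ⟨c • x, hx, ?_⟩
    rw [MulAction.orbit.coe_smul, ConjAct.units_smul_def]
  · rintro ⟨x', hx', hY⟩
    rw [← ConjAct.units_smul_def] at hY
    have hYmem : Y ∈ MulAction.orbit (ConjAct (GL (Fin 2) F)) (!![0, 1; 0, 0] : Matrix (Fin 2) (Fin 2) F) := by
      have hY' : Y = c⁻¹ • (x' : Matrix (Fin 2) (Fin 2) F) := by rw [hY, inv_smul_smul]
      rw [hY', ← MulAction.orbit.coe_smul]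
      exact (c⁻¹ • x').2
    refine ⟨⟨Y, hYmem⟩, ?_, rfl⟩
    have hx : c • (⟨Y, hYmem⟩ : ↥(MulAction.orbit (ConjAct (GL (Fin 2) F)) (!![0, 1; 0, 0] : Matrix (Fin 2) (Fin 2) F))) = x' :=
      Subtype.ext (by rw [MulAction.orbit.coe_smul, ← hY])
    rw [hx]
    exact hx'

variable [TopologicalSpace F] [IsTopologicalRing F] [T2Space F]

/-- **The regular nilpotent orbit is LOCALLY CLOSED in `𝔤𝔩₂(F)`** (closed cone `𝒩` ★ `isClosed_setOf_isNilpotent` with the point `0` removed) — the hypothesis of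
the Glimm–Effros open-mapping theorem ★ `Literature.MeasureTheory.Group.isOpenMap_smul_orbit_of_isLocallyClosed`. [cite: HarishChandra1999AdmissibleDistributions, §3 p. 8] -/
theorem isLocallyClosed_orbit_nilpOne :
    IsLocallyClosed (MulAction.orbit (ConjAct (GL (Fin 2) F)) (!![0, 1; 0, 0] : Matrix (Fin 2) (Fin 2) F)) := by
  rw [orbit_nilpOne_eq]
  exact (isClosed_setOf_isNilpotent (F := F)).isLocallyClosed.inter isOpen_compl_singleton.isLocallyClosed

/-- The closure of the orbit lies in the nilpotent cone `𝒩 = orbit ∪ {0}`. [cite: HarishChandra1999AdmissibleDistributions, §3 p. 8] -/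
theorem closure_orbit_nilpOne_subset :
    closure (MulAction.orbit (ConjAct (GL (Fin 2) F)) (!![0, 1; 0, 0] : Matrix (Fin 2) (Fin 2) F)) ⊆
      insert (0 : Matrix (Fin 2) (Fin 2) F) (MulAction.orbit (ConjAct (GL (Fin 2) F)) (!![0, 1; 0, 0] : Matrix (Fin 2) (Fin 2) F)) := by
  intro X hX
  have hnil : IsNilpotent X :=
    closure_minimal (fun Y hY => ((mem_orbit_nilpOne_iff Y).1 hY).1) (isClosed_setOf_isNilpotent (F := F)) hX
  rcases eq_zero_or_mem_orbit_nilpOne_of_isNilpotent hnil with h | h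
  · exact Or.inl h
  · exact Or.inr h

/-- The orbit is a Borel set. [cite: BernsteinZelevinsky1976, §1.5] -/
theorem measurableSet_orbit_nilpOne [MeasurableSpace (Matrix (Fin 2) (Fin 2) F)] [OpensMeasurableSpace (Matrix (Fin 2) (Fin 2) F)] :
    MeasurableSet (MulAction.orbit (ConjAct (GL (Fin 2) F)) (!![0, 1; 0, 0] : Matrix (Fin 2) (Fin 2) F)) := by
  rw [orbit_nilpOne_eq]
  exact (isClosed_setOf_isNilpotent (F := F)).measurableSet.inter isOpen_compl_singleton.measurableSet

omit [T2Space F] in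
/-- The orbit action `x ↦ g • x` on `↥(orbit)` is continuous (it is `X ↦ g X g⁻¹` under `val`). [cite: BernsteinZelevinsky1976, §1.5] -/
theorem continuous_smul_orbit_nilpOne (c : ConjAct (GL (Fin 2) F)) :
    Continuous fun x : ↥(MulAction.orbit (ConjAct (GL (Fin 2) F)) (!![0, 1; 0, 0] : Matrix (Fin 2) (Fin 2) F)) => c • x := by
  have h : Continuous fun x : ↥(MulAction.orbit (ConjAct (GL (Fin 2) F)) (!![0, 1; 0, 0] : Matrix (Fin 2) (Fin 2) F)) =>
      c • (x : Matrix (Fin 2) (Fin 2) F) := (continuous_const_smul c).comp continuous_subtype_val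
  exact h.subtype_mk _

end Orbit

/-! ## §2  The invariant measure `μ = val^* ν` on the orbit -/

section OrbitMeasure

variable {F : Type*} [Field F] [ValuativeRel F] [TopologicalSpace F] [IsNonarchimedeanLocalField F]

/-- `GL₂(F)` is second countable (closed in `M₂(F) × M₂(F)ᵐᵒᵖ` under `g ↦ (g, g⁻¹)`). [folklore] -/
theorem secondCountableTopology_gl_two : SecondCountableTopology (GL (Fin 2) F) := by
  haveI : SecondCountableTopology F := secondCountableTopology_localField F
  haveI : SecondCountableTopology (Matrix (Fin 2) (Fin 2) F) := inferInstanceAs (SecondCountableTopology (Fin 2 → Fin 2 → F))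
  haveI : SecondCountableTopology (Matrix (Fin 2) (Fin 2) F)ᵐᵒᵖ := MulOpposite.opHomeomorph.symm.secondCountableTopology
  exact Units.isEmbedding_embedProduct.secondCountableTopology

/-- The orbit `↥(orbit (ConjAct GL₂(F)) E₁₂)` is locally compact (locally closed in the locally compact `𝔤𝔩₂(F)`), hence a Baire space.
[cite: BernsteinZelevinsky1976, §1.5] -/
theorem locallyCompactSpace_orbit_nilpOne :
    LocallyCompactSpace ↥(MulAction.orbit (ConjAct (GL (Fin 2) F)) (!![0, 1; 0, 0] : Matrix (Fin 2) (Fin 2) F)) := by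
  haveI : T2Space F := (isLocalField F).toT2Space
  haveI : LocallyCompactSpace F := (isLocalField F).toLocallyCompactSpace
  haveI : LocallyCompactSpace (Matrix (Fin 2) (Fin 2) F) := Pi.locallyCompactSpace_of_finite
  exact (isLocallyClosed_orbit_nilpOne (F := F)).locallyCompactSpace

variable [MeasurableSpace F] [BorelSpace F] [MeasurableSpace (GL (Fin 2) F)] [BorelSpace (GL (Fin 2) F)]
  [MeasurableSpace (Matrix (Fin 2) (Fin 2) F)] [BorelSpace (Matrix (Fin 2) (Fin 2) F)]
  (κ : Measure ↥(glInt 2 F)) (dx : Measure F)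

omit [BorelSpace F] [BorelSpace (GL (Fin 2) F)] in
/-- `μ s = ν (val '' s)` for every `s ⊆ ↥(orbit)` (the orbit is measurable, `val` a measurable embedding). [cite: BernsteinZelevinsky1976, §1.18] -/
theorem comap_val_apply (s : Set ↥(MulAction.orbit (ConjAct (GL (Fin 2) F)) (!![0, 1; 0, 0] : Matrix (Fin 2) (Fin 2) F))) :
    (Measure.comap (Subtype.val : ↥(MulAction.orbit (ConjAct (GL (Fin 2) F)) (!![0, 1; 0, 0] : Matrix (Fin 2) (Fin 2) F)) → Matrix (Fin 2) (Fin 2) F)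
      ((κ.prod dx).map fun p : ↥(glInt 2 F) × F =>
        ((p.1 : GL (Fin 2) F) : Matrix (Fin 2) (Fin 2) F) * !![0, p.2; 0, 0] * ((((p.1 : GL (Fin 2) F))⁻¹ : GL (Fin 2) F) : Matrix (Fin 2) (Fin 2) F))) s =
    ((κ.prod dx).map fun p : ↥(glInt 2 F) × F =>
        ((p.1 : GL (Fin 2) F) : Matrix (Fin 2) (Fin 2) F) * !![0, p.2; 0, 0] * ((((p.1 : GL (Fin 2) F))⁻¹ : GL (Fin 2) F) : Matrix (Fin 2) (Fin 2) F))
      (Subtype.val '' s) := by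
  haveI : T2Space F := (isLocalField F).toT2Space
  exact comap_subtype_coe_apply (measurableSet_orbit_nilpOne (F := F)) _ s

/-- **`μ = val^* ν` is finite on compact sets** (★ `isFiniteMeasureOnCompacts_map_conjNilp`: `ν` is). [cite: HarishChandra1999AdmissibleDistributions, §3 p. 9] -/
theorem isFiniteMeasureOnCompacts_comap_val [IsFiniteMeasureOnCompacts κ] [IsFiniteMeasureOnCompacts dx] :
    IsFiniteMeasureOnCompacts (Measure.comap
      (Subtype.val : ↥(MulAction.orbit (ConjAct (GL (Fin 2) F)) (!![0, 1; 0, 0] : Matrix (Fin 2) (Fin 2) F)) → Matrix (Fin 2) (Fin 2) F)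
      ((κ.prod dx).map fun p : ↥(glInt 2 F) × F =>
        ((p.1 : GL (Fin 2) F) : Matrix (Fin 2) (Fin 2) F) * !![0, p.2; 0, 0] * ((((p.1 : GL (Fin 2) F))⁻¹ : GL (Fin 2) F) : Matrix (Fin 2) (Fin 2) F))) := by
  haveI := isFiniteMeasureOnCompacts_map_conjNilp (F := F) κ dx
  refine ⟨fun K hK => ?_⟩
  rw [comap_val_apply]
  exact (hK.image continuous_subtype_val).measure_lt_top

/-- **`μ = val^* ν` is `ConjAct GL₂(F)`-invariant** (★ `map_conj_map_conjNilp`: `Ad(g)_* ν = ν`, and `val '' ((g • ·)⁻¹' s) = (Ad g)⁻¹' (val '' s)`).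
[cite: HarishChandra1999AdmissibleDistributions, §3 pp. 8–10] [cite: BernsteinZelevinsky1976, §1.18] -/
theorem smulInvariantMeasure_comap_val [IsHaarMeasure κ] [dx.IsAddHaarMeasure] :
    SMulInvariantMeasure (ConjAct (GL (Fin 2) F)) ↥(MulAction.orbit (ConjAct (GL (Fin 2) F)) (!![0, 1; 0, 0] : Matrix (Fin 2) (Fin 2) F))
      (Measure.comap
        (Subtype.val : ↥(MulAction.orbit (ConjAct (GL (Fin 2) F)) (!![0, 1; 0, 0] : Matrix (Fin 2) (Fin 2) F)) → Matrix (Fin 2) (Fin 2) F)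
        ((κ.prod dx).map fun p : ↥(glInt 2 F) × F =>
          ((p.1 : GL (Fin 2) F) : Matrix (Fin 2) (Fin 2) F) * !![0, p.2; 0, 0] * ((((p.1 : GL (Fin 2) F))⁻¹ : GL (Fin 2) F) : Matrix (Fin 2) (Fin 2) F))) := by
  haveI : T2Space F := (isLocalField F).toT2Space
  haveI : SecondCountableTopology F := secondCountableTopology_localField F
  haveI : SecondCountableTopology (GL (Fin 2) F) := secondCountableTopology_gl_two (F := F)
  refine ⟨fun c s hs => ?_⟩
  have hO := measurableSet_orbit_nilpOne (F := F)
  have hAd : Measurable fun Y : Matrix (Fin 2) (Fin 2) F => ((ConjAct.ofConjAct c : GL (Fin 2) F) : Matrix (Fin 2) (Fin 2) F) * Y *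
      (((ConjAct.ofConjAct c)⁻¹ : GL (Fin 2) F) : Matrix (Fin 2) (Fin 2) F) := (continuous_conj (ConjAct.ofConjAct c)).measurable
  rw [comap_val_apply, comap_val_apply, image_val_preimage_smul, ← Measure.map_apply hAd (hO.subtype_image hs),
    map_conj_map_conjNilp κ dx (ConjAct.ofConjAct c)]

/-- **`ν` is carried by the orbit**: `ν((orbit)ᶜ) = 0` (`(orbit)ᶜ ⊆ 𝒩ᶜ ∪ {0}`, ★ `map_conjNilp_apply_compl_setOf_isNilpotent`, ★ `map_conjNilp_apply_singleton_zero`).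
[cite: HarishChandra1999AdmissibleDistributions, §3 p. 9] -/
theorem map_conjNilp_apply_compl_orbit [SFinite κ] [dx.IsAddHaarMeasure] :
    ((κ.prod dx).map fun p : ↥(glInt 2 F) × F =>
        ((p.1 : GL (Fin 2) F) : Matrix (Fin 2) (Fin 2) F) * !![0, p.2; 0, 0] * ((((p.1 : GL (Fin 2) F))⁻¹ : GL (Fin 2) F) : Matrix (Fin 2) (Fin 2) F))
      (MulAction.orbit (ConjAct (GL (Fin 2) F)) (!![0, 1; 0, 0] : Matrix (Fin 2) (Fin 2) F))ᶜ = 0 := by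
  have h : (MulAction.orbit (ConjAct (GL (Fin 2) F)) (!![0, 1; 0, 0] : Matrix (Fin 2) (Fin 2) F))ᶜ ⊆
      {N : Matrix (Fin 2) (Fin 2) F | IsNilpotent N}ᶜ ∪ {0} := fun X hX => by
    by_cases h0 : X = 0
    · exact Or.inr h0
    · exact Or.inl fun hn => hX ((mem_orbit_nilpOne_iff X).2 ⟨hn, h0⟩)
  exact measure_mono_null h (measure_union_null (map_conjNilp_apply_compl_setOf_isNilpotent κ dx) (map_conjNilp_apply_singleton_zero κ dx))

/-- **Total mass**: `μ(X) = ν(orbit) = ν(𝔤𝔩₂(F)) = (κ ⊗ dx)(GL₂(𝒪) × F)`. [cite: HarishChandra1999AdmissibleDistributions, §3 p. 9] -/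
theorem comap_val_univ [SFinite κ] [dx.IsAddHaarMeasure] :
    (Measure.comap
      (Subtype.val : ↥(MulAction.orbit (ConjAct (GL (Fin 2) F)) (!![0, 1; 0, 0] : Matrix (Fin 2) (Fin 2) F)) → Matrix (Fin 2) (Fin 2) F)
      ((κ.prod dx).map fun p : ↥(glInt 2 F) × F =>
        ((p.1 : GL (Fin 2) F) : Matrix (Fin 2) (Fin 2) F) * !![0, p.2; 0, 0] * ((((p.1 : GL (Fin 2) F))⁻¹ : GL (Fin 2) F) : Matrix (Fin 2) (Fin 2) F)))
      Set.univ = (κ.prod dx) Set.univ := by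
  haveI : T2Space F := (isLocalField F).toT2Space
  have hO := measurableSet_orbit_nilpOne (F := F)
  rw [comap_val_apply, Set.image_univ, Subtype.range_coe]
  have h := measure_add_measure_compl (μ := (κ.prod dx).map fun p : ↥(glInt 2 F) × F =>
    ((p.1 : GL (Fin 2) F) : Matrix (Fin 2) (Fin 2) F) * !![0, p.2; 0, 0] * ((((p.1 : GL (Fin 2) F))⁻¹ : GL (Fin 2) F) : Matrix (Fin 2) (Fin 2) F)) hO
  rw [map_conjNilp_apply_compl_orbit κ dx, add_zero] at h
  rw [h, Measure.map_apply (measurable_conjNilp (F := F)) MeasurableSet.univ, Set.preimage_univ]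

/-- **`μ ≠ 0`** for a Haar pair `(κ, dx)` (`μ(X) = κ(GL₂(𝒪)) · dx(F)`, both factors positive). [cite: HarishChandra1999AdmissibleDistributions, §3 p. 9] -/
theorem comap_val_ne_zero [IsHaarMeasure κ] [dx.IsAddHaarMeasure] :
    (Measure.comap
      (Subtype.val : ↥(MulAction.orbit (ConjAct (GL (Fin 2) F)) (!![0, 1; 0, 0] : Matrix (Fin 2) (Fin 2) F)) → Matrix (Fin 2) (Fin 2) F)
      ((κ.prod dx).map fun p : ↥(glInt 2 F) × F =>
        ((p.1 : GL (Fin 2) F) : Matrix (Fin 2) (Fin 2) F) * !![0, p.2; 0, 0] * ((((p.1 : GL (Fin 2) F))⁻¹ : GL (Fin 2) F) : Matrix (Fin 2) (Fin 2) F))) ≠ 0 := by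
  haveI : T2Space F := (isLocalField F).toT2Space
  haveI : SecondCountableTopology F := secondCountableTopology_localField F
  haveI : CompactSpace ↥(glInt 2 F) := isCompact_iff_compactSpace.1 (isCompact_glInt 2 F)
  intro h
  have h1 := comap_val_univ (F := F) κ dx
  rw [h, Measure.coe_zero, Pi.zero_apply, ← Set.univ_prod_univ, Measure.prod_prod] at h1
  have hκ : κ Set.univ ≠ 0 := (isOpen_univ.measure_pos κ ⟨⟨1, Subgroup.one_mem _⟩, Set.mem_univ _⟩).ne'
  have hdx : dx Set.univ ≠ 0 := (isOpen_univ.measure_pos dx ⟨0, Set.mem_univ _⟩).ne'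
  exact mul_ne_zero hκ hdx h1.symm

/-- **Integration on the orbit is the regular nilpotent orbital integral**: `∫_X f(val x) dμ(x) = ∫ f dν = μ_reg^{κ,dx}(f)` (the orbit has full `ν`-measure;
★ `integral_map_conjNilp`). [cite: HarishChandra1999AdmissibleDistributions, §3 p. 9] [cite: BernsteinZelevinsky1976, §1.18] -/
theorem integral_comp_val_comap_val [SFinite κ] [dx.IsAddHaarMeasure] {E : Type*} [NormedAddCommGroup E] [NormedSpace ℝ E]
    {f : Matrix (Fin 2) (Fin 2) F → E}
    (hf : AEStronglyMeasurable f ((κ.prod dx).map fun p : ↥(glInt 2 F) × F =>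
      ((p.1 : GL (Fin 2) F) : Matrix (Fin 2) (Fin 2) F) * !![0, p.2; 0, 0] * ((((p.1 : GL (Fin 2) F))⁻¹ : GL (Fin 2) F) : Matrix (Fin 2) (Fin 2) F))) :
    ∫ x : ↥(MulAction.orbit (ConjAct (GL (Fin 2) F)) (!![0, 1; 0, 0] : Matrix (Fin 2) (Fin 2) F)), f (x : Matrix (Fin 2) (Fin 2) F) ∂(Measure.comap
      (Subtype.val : ↥(MulAction.orbit (ConjAct (GL (Fin 2) F)) (!![0, 1; 0, 0] : Matrix (Fin 2) (Fin 2) F)) → Matrix (Fin 2) (Fin 2) F)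
      ((κ.prod dx).map fun p : ↥(glInt 2 F) × F =>
        ((p.1 : GL (Fin 2) F) : Matrix (Fin 2) (Fin 2) F) * !![0, p.2; 0, 0] * ((((p.1 : GL (Fin 2) F))⁻¹ : GL (Fin 2) F) : Matrix (Fin 2) (Fin 2) F))) =
    ∫ p : ↥(glInt 2 F) × F, f (((p.1 : GL (Fin 2) F) : Matrix (Fin 2) (Fin 2) F) * !![0, p.2; 0, 0] *
      ((((p.1 : GL (Fin 2) F))⁻¹ : GL (Fin 2) F) : Matrix (Fin 2) (Fin 2) F)) ∂(κ.prod dx) := by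
  haveI : T2Space F := (isLocalField F).toT2Space
  have hO := measurableSet_orbit_nilpOne (F := F)
  have hae : ∀ᵐ X ∂((κ.prod dx).map fun p : ↥(glInt 2 F) × F =>
      ((p.1 : GL (Fin 2) F) : Matrix (Fin 2) (Fin 2) F) * !![0, p.2; 0, 0] * ((((p.1 : GL (Fin 2) F))⁻¹ : GL (Fin 2) F) : Matrix (Fin 2) (Fin 2) F)),
      X ∈ MulAction.orbit (ConjAct (GL (Fin 2) F)) (!![0, 1; 0, 0] : Matrix (Fin 2) (Fin 2) F) :=
    mem_ae_iff.2 (map_conjNilp_apply_compl_orbit κ dx)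
  rw [integral_subtype_comap hO, Measure.restrict_eq_self_of_ae_mem hae, integral_map_conjNilp κ dx hf]

end OrbitMeasure

end Summit.HodgeConjecture.HodgeConjecture.Cruxes.H413.K2E3GL2RegularNilpotentOrbitSpace
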